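import Summits.ValiantsHypothesis.ValiantsHypothesis.Theorems.KPlusLogSqLawTropicalGradedWalkDomXOneGlue3
import Summits.ValiantsHypothesis.ValiantsHypothesis.Theorems.KPlusLogSqLawTropicalGradedWalkDomXOne7
import Summits.ValiantsHypothesis.ValiantsHypothesis.Theorems.KPlusLogSqLawTropicalGradedWalkDomXOne8
import Summits.ValiantsHypothesis.ValiantsHypothesis.Theorems.KPlusLogSqLawTropicalGradedWalkDomXOne9

/-!
# Dominance glue for the `u = 1` excursion, part D: the wrap columns and the dominance theorem `isDominant_X1`

GRW-lite `K = 4` graded-walk family (census side of the tropical root law, all `m`):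
dominance glue for the EXCURSION state `(w, 1, 1)`, `2 ≤ w ≤ m − 1` (potential `UX1` of `…PotX`); this part dispatches the rivals
of the WRAP columns `b ≥ w` (intended row `b − w`, class `0`) to the generated families of `…DomXOne7` – `…DomXOne9` and assembles
`isDominant_X1` via `isDominant_of_scaledPotential` (scale `1`).

Honest framing: census-side (lower-bound) construction; nothing here bears on `TropicalB` inside its window or on VP ≠ VNP.
-/

set_option linter.dupNamespace false
set_option autoImplicit false

namespace Summit.ValiantsHypothesis.ValiantsHypothesis.Theorems.LacunarySymmetroidMatrixDescartes.TropicalCensus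

namespace GradedWalk

open Summit.ValiantsHypothesis.ValiantsHypothesis.Theorems.MatrixDescartes.Negative

variable (n : ℕ)

/-! ### slack, wrap columns `b ≥ w` -/

set_option maxHeartbeats 400000 in
/-- slack of the type-X certificate for `u = 1`: wrap columns, rival rows above the diagonal. -/
theorem slackX1_wc_up (w : ℕ) (hw2 : 2 ≤ w) (hwn : w ≤ n) (a b : Fin (n + 1)) (l : Fin 4)
    (hp : ee n a b l ≠ 0) (hne : perm n w 1 1 b ≠ a ∨ lam n w 1 1 b ≠ l) (hwb : w ≤ (b : ℕ)) (hab : (a : ℕ) < (b : ℕ)) :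
    1 * (thX n w 1 * (dd n l : ℤ) - vv n a b l) <
      UX1 n w a + ((thX n w 1 * (dd n (lam n w 1 1 b) : ℤ) - vv n (perm n w 1 1 b) b (lam n w 1 1 b)) - UX1 n w (perm n w 1 1 b)) := by
  have huw : 1 < w := by omega
  have hbn : (b : ℕ) ≤ n := by omega
  have hr : ((perm n w 1 1 b : Fin (n + 1)) : ℕ) = (b : ℕ) - w := sigmaX_wrap n huw le_rfl hwn b hwb
  rw [lam_X1 n huw, if_pos hwb] at hne ⊢
  have hT0 : thX n w 1 * (dd n 0 : ℤ) - vv n (perm n w 1 1 b) b 0 = ((0 : ℤ) - 4 * mZ n * gG n ^ 2 * (((w) : ℕ) : ℤ) ^ 2) :=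
    X1up0_of n (show ((perm n w 1 1 b : Fin (n + 1)) : ℕ) < (b : ℕ) by rw [hr]; omega) w (by rw [hr]; omega)
  have hUr : UX1 n w ((perm n w 1 1 b : Fin (n + 1)) : ℕ) = gG n * thX n w 1 * ((((b : ℕ) - w) : ℕ) : ℤ) := by
    rw [UX1_pre n (show ((perm n w 1 1 b : Fin (n + 1)) : ℕ) ≤ n - w by rw [hr]; omega), hr]
  have hl : l = 0 ∨ l = 1 := by
    rcases (show l = 0 ∨ l = 1 ∨ l = 2 ∨ l = 3 by fin_cases l <;> simp) with rfl | rfl | rfl | rfl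
    · exact Or.inl rfl
    · exact Or.inr rfl
    · exact absurd (ee_upper_ge_two n hab 2 (by decide)) hp
    · exact absurd (ee_upper_ge_two n hab 3 (by decide)) hp
  obtain ⟨E0, hE0⟩ : ∃ E0, (a : ℕ) + E0 = (b : ℕ) := ⟨(b : ℕ) - (a : ℕ), by omega⟩
  have hX0 := X1up0_of n (w := w) hab E0 hE0
  have hX1 := X1up1_of n (w := w) hab E0 hE0
  rcases Nat.lt_or_ge (a : ℕ) (n + 1 - w) with hpre | hblk
  · -- pre-block rows: `UX1 a = g θ a`
    have hY : UX1 n w a - UX1 n w ((perm n w 1 1 b : Fin (n + 1)) : ℕ) =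
        (gG n * thX n w 1 * ((((b : ℕ) - E0) : ℕ) : ℤ) - gG n * thX n w 1 * ((((b : ℕ) - w) : ℕ) : ℤ)) := by
      rw [hUr, UX1_pre n (show (a : ℕ) ≤ n - w by omega), show (a : ℕ) = (b : ℕ) - E0 by omega]
    rcases Nat.lt_trichotomy (a : ℕ) ((b : ℕ) - w) with hlt | heq | hgt
    · rcases hl with rfl | rfl
      · exact slack_of (X1_wc_w0_up n w b E0 hw2 (by omega) (by omega) hbn) hX0 hT0 hY
      · exact slack_of (X1_wc_cn_up n w b E0 hw2 (by omega) (by omega) hbn) hX1 hT0 hY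
    · -- the intended position: only class 1 is a rival
      have hrot : perm n w 1 1 b = a := Fin.ext (by rw [hr]; omega)
      rcases hl with rfl | rfl
      · exact absurd rfl (hne.resolve_left (fun h => h hrot))
      · have hE0w : E0 = w := by omega
        rw [hE0w] at hX1
        have hY0 : UX1 n w a - UX1 n w ((perm n w 1 1 b : Fin (n + 1)) : ℕ) = 0 := by rw [hrot]; ring
        exact slack_of0 (X1_wc_cn_at n w b hw2 hwb hbn) hX1 hT0 hY0
    · rcases hl with rfl | rfl
      · exact slack_of (X1_wc_w0_dnP n w b E0 (by omega) (by omega) hwb (by omega)) hX0 hT0 hY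
      · exact slack_of (X1_wc_cn_dnP n w b E0 (by omega) (by omega) hwb (by omega)) hX1 hT0 hY
  · -- block rows `a = (m − w) + j`
    obtain ⟨j, hj⟩ : ∃ j, (a : ℕ) = (n + 1 - w) + j := ⟨(a : ℕ) - (n + 1 - w), by omega⟩
    have hE01 : 1 ≤ E0 := by omega
    rcases Nat.lt_or_ge j 3 with hj3 | hj3
    · rcases Nat.lt_or_ge j 1 with hj1 | hj1
      · have hbE : (b : ℕ) = (n + 1 - w) + E0 := by omega
        have hY : UX1 n w a - UX1 n w ((perm n w 1 1 b : Fin (n + 1)) : ℕ) =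
            ((gG n * thX n w 1 * (((n + 1 - w + (0)) : ℕ) : ℤ) + SX1R1 n w) - gG n * thX n w 1 * ((((n + 1 - w) + E0 - w) : ℕ) : ℤ)) := by
          rw [hUr, UX1_R1 n hwn (by omega), hbE]
        rw [hbE] at hX1
        rcases hl with rfl | rfl
        · exact slack_of (X1_wc_w0_R1 n w E0 (n + 1 - w) hE01 (by omega) (by omega) (by omega)) hX0 hT0 hY
        · exact slack_of (X1_wc_cn_R1 n w E0 (n + 1 - w) hE01 (by omega) (by omega) (by omega)) hX1 hT0 hY
      · rcases Nat.lt_or_ge j 2 with hj2 | hj2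
        · have hbE : (b : ℕ) = (n + 1 - w) + 1 + E0 := by omega
          have hY : UX1 n w a - UX1 n w ((perm n w 1 1 b : Fin (n + 1)) : ℕ) =
              ((gG n * thX n w 1 * (((n + 1 - w + (1)) : ℕ) : ℤ) + SX1R2 n w) - gG n * thX n w 1 * ((((n + 1 - w) + 1 + E0 - w) : ℕ) : ℤ)) := by
            rw [hUr, UX1_R2 n hwn (by omega), hbE]
          rw [hbE] at hX1
          rcases hl with rfl | rfl
          · exact slack_of (X1_wc_w0_R2 n w E0 (n + 1 - w) hE01 (by omega) (by omega) (by omega)) hX0 hT0 hY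
          · exact slack_of (X1_wc_cn_R2 n w E0 (n + 1 - w) hE01 (by omega) (by omega) (by omega)) hX1 hT0 hY
        · have hbE : (b : ℕ) = (n + 1 - w) + 2 + E0 := by omega
          have hY : UX1 n w a - UX1 n w ((perm n w 1 1 b : Fin (n + 1)) : ℕ) =
              ((gG n * thX n w 1 * (((n + 1 - w + (2)) : ℕ) : ℤ) + SX1P n) - gG n * thX n w 1 * ((((n + 1 - w) + 2 + E0 - w) : ℕ) : ℤ)) := by
            rw [hUr, UX1_RP n hwn (by omega), hbE]
          rw [hbE] at hX1
          rcases hl with rfl | rfl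
          · exact slack_of (X1_wc_w0_RP n w E0 (n + 1 - w) hE01 (by omega) (by omega) (by omega)) hX0 hT0 hY
          · exact slack_of (X1_wc_cn_RP n w E0 (n + 1 - w) hE01 (by omega) (by omega) (by omega)) hX1 hT0 hY
    · have hbE : (b : ℕ) = (n + 1 - w) + j + E0 := by omega
      have hY : UX1 n w a - UX1 n w ((perm n w 1 1 b : Fin (n + 1)) : ℕ) =
          ((gG n * thX n w 1 * (((n + 1 - w + (j)) : ℕ) : ℤ) + SX1L n w (j)) - gG n * thX n w 1 * ((((n + 1 - w) + j + E0 - w) : ℕ) : ℤ)) := by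
        rw [hUr, UX1_RL n j hwn hj3 hj, hbE]
      rw [hbE] at hX1
      rcases hl with rfl | rfl
      · exact slack_of (X1_wc_w0_RL n w E0 j (n + 1 - w) hE01 hj3 (by omega) (by omega) (by omega)) hX0 hT0 hY
      · exact slack_of (X1_wc_cn_RL n w E0 j (n + 1 - w) hE01 hj3 (by omega) (by omega) (by omega)) hX1 hT0 hY

set_option maxHeartbeats 400000 in
/-- slack of the type-X certificate for `u = 1`: wrap columns, rival rows on or below the diagonal. -/
theorem slackX1_wc_dn (w : ℕ) (hw2 : 2 ≤ w) (hwn : w ≤ n) (a b : Fin (n + 1)) (l : Fin 4)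
    (hp : ee n a b l ≠ 0) (hwb : w ≤ (b : ℕ)) (hba : (b : ℕ) ≤ (a : ℕ)) :
    1 * (thX n w 1 * (dd n l : ℤ) - vv n a b l) <
      UX1 n w a + ((thX n w 1 * (dd n (lam n w 1 1 b) : ℤ) - vv n (perm n w 1 1 b) b (lam n w 1 1 b)) - UX1 n w (perm n w 1 1 b)) := by
  have huw : 1 < w := by omega
  have hbn : (b : ℕ) ≤ n := by omega
  have han : (a : ℕ) ≤ n := by omega
  have hr : ((perm n w 1 1 b : Fin (n + 1)) : ℕ) = (b : ℕ) - w := sigmaX_wrap n huw le_rfl hwn b hwb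
  rw [lam_X1 n huw, if_pos hwb]
  have hT0 : thX n w 1 * (dd n 0 : ℤ) - vv n (perm n w 1 1 b) b 0 = ((0 : ℤ) - 4 * mZ n * gG n ^ 2 * (((w) : ℕ) : ℤ) ^ 2) :=
    X1up0_of n (show ((perm n w 1 1 b : Fin (n + 1)) : ℕ) < (b : ℕ) by rw [hr]; omega) w (by rw [hr]; omega)
  have hUr : UX1 n w ((perm n w 1 1 b : Fin (n + 1)) : ℕ) = gG n * thX n w 1 * ((((b : ℕ) - w) : ℕ) : ℤ) := by
    rw [UX1_pre n (show ((perm n w 1 1 b : Fin (n + 1)) : ℕ) ≤ n - w by rw [hr]; omega), hr]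
  -- the potential difference by row regime of `a`
  rcases Nat.eq_or_lt_of_le hba with hab | hlow
  · -- the diagonal cell
    have hab' : (a : ℕ) = (b : ℕ) := hab.symm
    have hX0 : thX n w 1 * (dd n 0 : ℤ) - vv n a b 0 = thX n w 1 * 0 - 0 := by rw [dd_cast_zero, vv_diag_zero n hab']
    have hXl : l ≠ 0 → thX n w 1 * (dd n l : ℤ) - vv n a b l ≤ thX n w 1 * d1 n - v1 n (n + 1) ((b : ℕ)) := fun hl =>
      X1lift_fut n huw hwn l hl hp hba (n + 1) (by omega) (by omega)
    rcases Nat.lt_or_ge (a : ℕ) (n + 1 - w) with hpre | hblk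
    · have hY : UX1 n w a - UX1 n w ((perm n w 1 1 b : Fin (n + 1)) : ℕ) =
          (gG n * thX n w 1 * ((((b : ℕ)) : ℕ) : ℤ) - gG n * thX n w 1 * ((((b : ℕ) - w) : ℕ) : ℤ)) := by
        rw [hUr, UX1_pre n (show (a : ℕ) ≤ n - w by omega), hab']
      by_cases hcl : l = 0
      · subst hcl; exact slack_of (X1_wc_dg0_P n w b hw2 hwb (by omega)) hX0 hT0 hY
      · exact slack_le (X1_wc_dgm_P n w b hw2 hwb (by omega)) (hXl hcl) hT0 hY
    · obtain ⟨j, hj⟩ : ∃ j, (a : ℕ) = (n + 1 - w) + j := ⟨(a : ℕ) - (n + 1 - w), by omega⟩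
      rcases Nat.lt_or_ge j 3 with hj3 | hj3
      · rcases Nat.lt_or_ge j 1 with hj1 | hj1
        · have hY : UX1 n w a - UX1 n w ((perm n w 1 1 b : Fin (n + 1)) : ℕ) =
              ((gG n * thX n w 1 * (((n + 1 - w + (0)) : ℕ) : ℤ) + SX1R1 n w) - gG n * thX n w 1 * ((((b : ℕ) - w) : ℕ) : ℤ)) := by
            rw [hUr, UX1_R1 n hwn (by omega)]
          by_cases hcl : l = 0
          · subst hcl; exact slack_of (X1_wc_dg0_R1 n w b hw2 hwb (by omega)) hX0 hT0 hY
          · exact slack_le (X1_wc_dgm_R1 n w b hw2 hwb (by omega)) (hXl hcl) hT0 hY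
        · rcases Nat.lt_or_ge j 2 with hj2 | hj2
          · have hY : UX1 n w a - UX1 n w ((perm n w 1 1 b : Fin (n + 1)) : ℕ) =
                ((gG n * thX n w 1 * (((n + 1 - w + (1)) : ℕ) : ℤ) + SX1R2 n w) - gG n * thX n w 1 * ((((b : ℕ) - w) : ℕ) : ℤ)) := by
              rw [hUr, UX1_R2 n hwn (by omega)]
            by_cases hcl : l = 0
            · subst hcl; exact slack_of (X1_wc_dg0_R2 n w b hw2 hwb (by omega)) hX0 hT0 hY
            · exact slack_le (X1_wc_dgm_R2 n w b hw2 hwb (by omega)) (hXl hcl) hT0 hY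
          · have hY : UX1 n w a - UX1 n w ((perm n w 1 1 b : Fin (n + 1)) : ℕ) =
                ((gG n * thX n w 1 * (((n + 1 - w + (2)) : ℕ) : ℤ) + SX1P n) - gG n * thX n w 1 * ((((b : ℕ) - w) : ℕ) : ℤ)) := by
              rw [hUr, UX1_RP n hwn (by omega)]
            by_cases hcl : l = 0
            · subst hcl; exact slack_of (X1_wc_dg0_RP n w b (by omega) hwb (by omega)) hX0 hT0 hY
            · exact slack_le (X1_wc_dgm_RP n w b (by omega) hwb (by omega)) (hXl hcl) hT0 hY
      · have hY : UX1 n w a - UX1 n w ((perm n w 1 1 b : Fin (n + 1)) : ℕ) =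
            ((gG n * thX n w 1 * (((n + 1 - w + (j)) : ℕ) : ℤ) + SX1L n w (j)) - gG n * thX n w 1 * ((((b : ℕ) - w) : ℕ) : ℤ)) := by
          rw [hUr, UX1_RL n j hwn hj3 hj]
        by_cases hcl : l = 0
        · subst hcl; exact slack_of (X1_wc_dg0_RL n w b j hj3 (by omega) hwb (by omega)) hX0 hT0 hY
        · exact slack_le (X1_wc_dgm_RL n w b j hj3 (by omega) hwb (by omega)) (hXl hcl) hT0 hY
  · -- below the diagonal: future level `E = m + b − a ≥ w + 1`, class 1 best
    obtain ⟨E, hE⟩ : ∃ E, n + 1 + (b : ℕ) - (a : ℕ) = E := ⟨_, rfl⟩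
    have hwE : w + 1 ≤ E := by omega
    have hcl : l ≠ 0 := fun h0 => by subst h0; exact hp (ee_lower_zero n hlow)
    have hXl := X1lift_fut n huw hwn l hcl hp hba E hE hwE
    rcases Nat.lt_or_ge (a : ℕ) (n + 1 - w) with hpre | hblk
    · have hY : UX1 n w a - UX1 n w ((perm n w 1 1 b : Fin (n + 1)) : ℕ) =
          (gG n * thX n w 1 * (((n + 1 + (b : ℕ) - E) : ℕ) : ℤ) - gG n * thX n w 1 * ((((b : ℕ) - w) : ℕ) : ℤ)) := by
        rw [hUr, UX1_pre n (show (a : ℕ) ≤ n - w by omega), show (a : ℕ) = n + 1 + (b : ℕ) - E by omega]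
      exact slack_le (X1_wc_lo_P n w b E hw2 hwb (by omega) (by omega)) hXl hT0 hY
    · obtain ⟨j, hj⟩ : ∃ j, (a : ℕ) = (n + 1 - w) + j := ⟨(a : ℕ) - (n + 1 - w), by omega⟩
      rcases Nat.lt_or_ge j 3 with hj3 | hj3
      · rcases Nat.lt_or_ge j 1 with hj1 | hj1
        · have hEq : E = w + (b : ℕ) := by omega
          subst hEq
          have hY : UX1 n w a - UX1 n w ((perm n w 1 1 b : Fin (n + 1)) : ℕ) =
              ((gG n * thX n w 1 * (((n + 1 - w + (0)) : ℕ) : ℤ) + SX1R1 n w) - gG n * thX n w 1 * ((((b : ℕ) - w) : ℕ) : ℤ)) := by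
            rw [hUr, UX1_R1 n hwn (by omega)]
          exact slack_le (X1_wc_lo_R1 n w b hw2 hwb (by omega)) hXl hT0 hY
        · rcases Nat.lt_or_ge j 2 with hj2 | hj2
          · have hEq : E = w + (b : ℕ) - 1 := by omega
            subst hEq
            have hY : UX1 n w a - UX1 n w ((perm n w 1 1 b : Fin (n + 1)) : ℕ) =
                ((gG n * thX n w 1 * (((n + 1 - w + (1)) : ℕ) : ℤ) + SX1R2 n w) - gG n * thX n w 1 * ((((b : ℕ) - w) : ℕ) : ℤ)) := by
              rw [hUr, UX1_R2 n hwn (by omega)]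
            exact slack_le (X1_wc_lo_R2 n w b hw2 hwb (by omega)) hXl hT0 hY
          · have hEq : E = w + (b : ℕ) - 2 := by omega
            subst hEq
            have hY : UX1 n w a - UX1 n w ((perm n w 1 1 b : Fin (n + 1)) : ℕ) =
                ((gG n * thX n w 1 * (((n + 1 - w + (2)) : ℕ) : ℤ) + SX1P n) - gG n * thX n w 1 * ((((b : ℕ) - w) : ℕ) : ℤ)) := by
              rw [hUr, UX1_RP n hwn (by omega)]
            exact slack_le (X1_wc_lo_RP n w b (by omega) hwb (by omega)) hXl hT0 hY
      · have hEq : E = w + (b : ℕ) - j := by omega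
        subst hEq
        have hY : UX1 n w a - UX1 n w ((perm n w 1 1 b : Fin (n + 1)) : ℕ) =
            ((gG n * thX n w 1 * (((n + 1 - w + (j)) : ℕ) : ℤ) + SX1L n w (j)) - gG n * thX n w 1 * ((((b : ℕ) - w) : ℕ) : ℤ)) := by
          rw [hUr, UX1_RL n j hwn hj3 hj]
        exact slack_le (X1_wc_lo_RL n w b j hj3 (by omega) hwb (by omega)) hXl hT0 hY

/-! ### the dominance theorem for the excursion states `(w, 1, 1)` of the phases `2 ≤ w < m` -/

/-- the intended incidences of the `u = 1` excursion state are present. -/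
theorem present_X1 (w : ℕ) (hw2 : 2 ≤ w) (hwn : w ≤ n) (i : Fin (n + 1)) :
    ee n (perm n w 1 1 i) i (lam n w 1 1 i) ≠ 0 := by
  have hw1 : w ≤ n + 1 := by omega
  have huw : 1 < w := by omega
  rw [lam_X1 n huw]
  by_cases hwi : w ≤ (i : ℕ)
  · rw [if_pos hwi]
    have hr := sigmaX_wrap n huw le_rfl hwn i hwi
    exact ee_upper_zero_ne n (show ((perm n w 1 1 i : Fin (n + 1)) : ℕ) < (i : ℕ) by rw [hr]; omega)
  · rw [if_neg hwi]
    by_cases h0 : (i : ℕ) = 0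
    · rw [if_pos h0]
      have hr := sigmaX_um1 n huw hw1 i (by omega)
      exact ee_lower_ne n (show (i : ℕ) < ((perm n w 1 1 i : Fin (n + 1)) : ℕ) by rw [hr]; omega) 3 (by decide)
    · rw [if_neg h0]
      by_cases h1 : (i : ℕ) = 1
      · have hr := sigmaX_u n huw hwn i h1
        rcases Nat.lt_or_ge (i : ℕ) ((perm n w 1 1 i : Fin (n + 1)) : ℕ) with hlow | hge
        · exact ee_lower_ne n hlow 1 (by decide)
        · exact ee_diag_ne n (show ((perm n w 1 1 i : Fin (n + 1)) : ℕ) = (i : ℕ) by rw [hr]; omega) 1 (by decide)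
      · have hr := sigmaX_blk n huw hw1 i (by omega) (by omega) h1
        exact ee_lower_ne n (show (i : ℕ) < ((perm n w 1 1 i : Fin (n + 1)) : ℕ) by rw [hr]; omega) 1 (by decide)

/-- **The excursion state `(w, 1, 1)`, `2 ≤ w < m`, of the GRW-lite design is the unique optimum at its slope.** -/
theorem isDominant_X1 (w : ℕ) (hw2 : 2 ≤ w) (hwn : w ≤ n) :
    IsDominant (dd n) (vv n) (ee n) (theta n w 1 1) (cterm n w 1 1) := by
  have huw : 1 < w := by omega
  rw [theta_X n huw (by omega)]
  unfold cterm
  refine isDominant_of_scaledPotential (dd n) (vv n) (ee n) (thX n w 1) (perm n w 1 1) (lam n w 1 1) 1 one_pos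
    (fun a => UX1 n w a)
    (fun b => (thX n w 1 * (dd n (lam n w 1 1 b) : ℤ) - vv n (perm n w 1 1 b) b (lam n w 1 1 b)) - UX1 n w (perm n w 1 1 b)) ?_ ?_ ?_
  · exact present_X1 n w hw2 hwn
  · intro i; ring
  · intro a b l hp hne
    by_cases hwb : w ≤ (b : ℕ)
    · rcases Nat.lt_or_ge (a : ℕ) (b : ℕ) with hab | hba
      · exact slackX1_wc_up n w hw2 hwn a b l hp hne hwb hab
      · exact slackX1_wc_dn n w hw2 hwn a b l hp hwb hba
    · have hbw : (b : ℕ) < w := Nat.lt_of_not_le hwb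
      by_cases h0 : (b : ℕ) = 0
      · exact slackX1_c0 n w hw2 hwn a b l hp hne h0
      · by_cases h1 : (b : ℕ) = 1
        · exact slackX1_c1 n w hw2 hwn a b l hp hne h1
        · by_cases h2 : (b : ℕ) = 2
          · exact slackX1_c2 n w hw2 hwn a b l hp hne h2 hbw
          · rcases Nat.lt_or_ge (b : ℕ) (a : ℕ) with hlow | hab
            · exact slackX1_ge_lo n w hw2 hwn a b l hp hne (by omega) hbw hlow
            · exact slackX1_ge_hi n w hw2 hwn a b l hp (by omega) hbw hab

end GradedWalk

end Summit.ValiantsHypothesis.ValiantsHypothesis.Theorems.LacunarySymmetroidMatrixDescartes.TropicalCensus
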